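import Literature.NumberTheory.EllipticCurves.Rubin1991.TwoVariableCMLines
import HarnessLib

set_option autoImplicit false

/-!
# Reading a unit coefficient of a bounded `p`-adic power series off finitely many VALUES: the
# dual-Vandermonde certificate («`λ`-invariant from special values»)

Topic `NumberTheory/EllipticCurves` (receptacle `𝒪_{ℂ_p}⟦T⟧` of the tree's `p`-adic `L`-functions,
values `IntSeries.HasValueAt`). For `F = Σ f_j T^j ∈ 𝒪_{ℂ_p}⟦T⟧` and points `x_0, …, x_{m-1}` of a
closed disc `‖x‖ ≤ ‖ϖ‖ < 1`, the value `F(x_t)` agrees with the truncation `Σ_{j ≤ N} f_j x_t^j` up to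
`‖ϖ‖^{N+1}` (`norm_sub_truncation_le`). Hence, if a DUAL VECTOR `c` (norms `≤ 1`) for the nodes kills
the monomials `x^j`, `j ≤ N`, `j ≠ k`, and sends `x^k` to `ϖ^k` — the `k`-th row of the inverse
Vandermonde matrix of `x_t/ϖ`, which exists over `𝒪` as soon as the `x_t/ϖ` are pairwise incongruent
modulo `𝔪` — then `Σ_t c_t F(x_t) = f_k ϖ^k + O(ϖ^{N+1})`, so (`k ≤ N`):

* `isUnit_coeff_of_dualCertificate`: `‖Σ_t c_t F(x_t)‖ = ‖ϖ‖^k ⟹ f_k ∈ 𝒪^×`;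
* `not_isUnit_coeff_of_dualCertificate`: `‖Σ_t c_t F(x_t)‖ < ‖ϖ‖^k ⟹ f_k ∉ 𝒪^×`.

So the residual order `λ̄(F) = min {k : f_k ∈ 𝒪^×}` (the `λ`-invariant when `μ = 0`) is CERTIFIED by
`λ̄ + 1` exact evaluations of `F` at interpolation points — the classical way Iwasawa invariants of
`p`-adic `L`-functions are computed from special values (Kummer congruences / Iwasawa's construction of
the Kubota–Leopoldt function from Bernoulli numbers, Washington §5.2, §7.2), in certificate form: the
numerics supply `c`, the values and one norm, the kernel checks three finite identities.
Written for the refutation road of crux `CycTangentCM.CycTangentBound` (stmt-BirchSwinnertonDyer-22628,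
`Cruxes/CycTangentBound/Lines/tangent_cone_parity_falsifier.md`: `m₀ ≤ λ̄` of the Katz `ψ`-power line,
read from the Hurwitz-type numbers `e(t)`), usable by any cell that books a `λ`-invariant from values.
THEOREMS ONLY (no definition, no named fact, no `sorry`).

References: L. Washington, *Introduction to Cyclotomic Fields*, GTM 83, §5.2 (Thm. 5.11, the power
series from special values), §7.2 (`λ` from congruences); F. Gouvêa, *p-adic Numbers*, §5.6
(Strassman / truncation bounds on closed discs).
-/

noncomputable section

open scoped Classical
open PowerSeries

namespace Literature.NumberTheory.EllipticCurves.IntSeries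

variable {p : ℕ} [Fact p.Prime]

/-- **Truncation bound on a closed disc.** If `F ∈ 𝒪_{ℂ_p}⟦T⟧` has value `v` at `x` with
`‖x‖ ≤ ‖ϖ‖ < 1`, then `‖v − Σ_{j ≤ N} [T^j]F · x^j‖ ≤ ‖ϖ‖^{N+1}` (the tail is an ultrametric sum of
terms of norm `≤ ‖ϖ‖^{N+1}`). [cite: Gouvea1993PadicNumbers, §5.6 (Cor. 5.6.3, proof)] -/
theorem norm_sub_truncation_le {F : PowerSeries (PadicComplexInt p)} {x v ϖ : ℂ_[p]}
    (hϖ : ‖ϖ‖ < 1) (hx : ‖x‖ ≤ ‖ϖ‖) (hv : IntSeries.HasValueAt F x v) (N : ℕ) :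
    ‖v - ∑ j ∈ Finset.range (N + 1), ((PowerSeries.coeff j F : PadicComplexInt p) : ℂ_[p]) * x ^ j‖ ≤
      ‖ϖ‖ ^ (N + 1) := by
  have htail : HasSum (fun j : ℕ ↦
      ((PowerSeries.coeff (j + (N + 1)) F : PadicComplexInt p) : ℂ_[p]) * x ^ (j + (N + 1)))
      (v - ∑ j ∈ Finset.range (N + 1), ((PowerSeries.coeff j F : PadicComplexInt p) : ℂ_[p]) * x ^ j) :=
    (hasSum_nat_add_iff' (N + 1)).mpr hv
  rw [← htail.tsum_eq]
  refine IsUltrametricDist.norm_tsum_le_of_forall_le_of_nonneg (pow_nonneg (norm_nonneg _) _)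
    fun j ↦ ?_
  rw [norm_mul, norm_pow]
  calc ‖((PowerSeries.coeff (j + (N + 1)) F : PadicComplexInt p) : ℂ_[p])‖ * ‖x‖ ^ (j + (N + 1))
      ≤ 1 * ‖x‖ ^ (j + (N + 1)) :=
        mul_le_mul_of_nonneg_right (norm_coe_padicComplexInt_le_one _) (pow_nonneg (norm_nonneg _) _)
    _ = ‖x‖ ^ j * ‖x‖ ^ (N + 1) := by rw [one_mul, pow_add]
    _ ≤ 1 * ‖ϖ‖ ^ (N + 1) := by
        refine mul_le_mul (pow_le_one₀ (norm_nonneg _) (hx.trans hϖ.le)) ?_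
          (pow_nonneg (norm_nonneg _) _) zero_le_one
        exact pow_le_pow_left₀ (norm_nonneg _) hx _
    _ = ‖ϖ‖ ^ (N + 1) := one_mul _

/-- **The dual pairing isolates one coefficient up to `O(ϖ^{N+1})`.** With nodes `x_t` (`‖x_t‖ ≤ ‖ϖ‖`),
values `F(x_t) = v_t`, `k ≤ N`, and a dual vector `c` (`‖c_t‖ ≤ 1`) with `Σ_t c_t x_t^j = [j = k]·ϖ^k`
for all `j ≤ N`: `‖Σ_t c_t v_t − [T^k]F · ϖ^k‖ ≤ ‖ϖ‖^{N+1}`. [cite: Washington1997, §5.2 Thm. 5.11 (proof)] -/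
theorem norm_dualPairing_sub_coeff_le {F : PowerSeries (PadicComplexInt p)} {m N k : ℕ}
    {x v c : Fin m → ℂ_[p]} {ϖ : ℂ_[p]} (hϖ : ‖ϖ‖ < 1) (hx : ∀ t, ‖x t‖ ≤ ‖ϖ‖)
    (hc : ∀ t, ‖c t‖ ≤ 1) (hv : ∀ t, IntSeries.HasValueAt F (x t) (v t)) (hk : k ≤ N)
    (hdual : ∀ j ≤ N, ∑ t, c t * x t ^ j = if j = k then ϖ ^ k else 0) :
    ‖∑ t, c t * v t - ((PowerSeries.coeff k F : PadicComplexInt p) : ℂ_[p]) * ϖ ^ k‖ ≤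
      ‖ϖ‖ ^ (N + 1) := by
  -- the truncations and their errors
  set S : Fin m → ℂ_[p] := fun t ↦
    ∑ j ∈ Finset.range (N + 1), ((PowerSeries.coeff j F : PadicComplexInt p) : ℂ_[p]) * x t ^ j
    with hS
  have herr : ∀ t, ‖v t - S t‖ ≤ ‖ϖ‖ ^ (N + 1) := fun t ↦ norm_sub_truncation_le hϖ (hx t) (hv t) N
  -- the dual pairing of the truncations is exactly `f_k ϖ^k`
  have hpair : ∑ t, c t * S t = ((PowerSeries.coeff k F : PadicComplexInt p) : ℂ_[p]) * ϖ ^ k := by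
    calc ∑ t, c t * S t
        = ∑ t, ∑ j ∈ Finset.range (N + 1),
            ((PowerSeries.coeff j F : PadicComplexInt p) : ℂ_[p]) * (c t * x t ^ j) := by
          refine Finset.sum_congr rfl fun t _ ↦ ?_
          rw [hS, Finset.mul_sum]
          exact Finset.sum_congr rfl fun j _ ↦ by ring
      _ = ∑ j ∈ Finset.range (N + 1),
            ((PowerSeries.coeff j F : PadicComplexInt p) : ℂ_[p]) * ∑ t, c t * x t ^ j := by
          rw [Finset.sum_comm]
          exact Finset.sum_congr rfl fun j _ ↦ by rw [Finset.mul_sum]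
      _ = ∑ j ∈ Finset.range (N + 1),
            ((PowerSeries.coeff j F : PadicComplexInt p) : ℂ_[p]) * (if j = k then ϖ ^ k else 0) := by
          refine Finset.sum_congr rfl fun j hj ↦ ?_
          rw [hdual j (Nat.lt_succ_iff.mp (Finset.mem_range.mp hj))]
      _ = ((PowerSeries.coeff k F : PadicComplexInt p) : ℂ_[p]) * ϖ ^ k := by
          rw [Finset.sum_eq_single k]
          · rw [if_pos rfl]
          · intro j _ hjk
            rw [if_neg hjk, mul_zero]
          · intro h
            exact absurd (Finset.mem_range.mpr (Nat.lt_succ_of_le hk)) h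
  -- so the pairing of the values differs from `f_k ϖ^k` by the pairing of the errors
  have hsplit : ∑ t, c t * v t - ((PowerSeries.coeff k F : PadicComplexInt p) : ℂ_[p]) * ϖ ^ k =
      ∑ t, c t * (v t - S t) := by
    rw [← hpair, ← Finset.sum_sub_distrib]
    exact Finset.sum_congr rfl fun t _ ↦ by ring
  rw [hsplit]
  refine IsUltrametricDist.norm_sum_le_of_forall_le_of_nonneg (pow_nonneg (norm_nonneg _) _)
    fun t _ ↦ ?_
  rw [norm_mul]
  calc ‖c t‖ * ‖v t - S t‖ ≤ 1 * ‖ϖ‖ ^ (N + 1) :=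
        mul_le_mul (hc t) (herr t) (norm_nonneg _) zero_le_one
    _ = ‖ϖ‖ ^ (N + 1) := one_mul _

/-- **Unit-coefficient certificate from values.** In the setting of `norm_dualPairing_sub_coeff_le`
with `0 < ‖ϖ‖ < 1`: if the dual pairing of the VALUES has norm exactly `‖ϖ‖^k`, then the coefficient
`[T^k]F` is a unit of `𝒪_{ℂ_p}` (ultrametric: a perturbation of norm `≤ ‖ϖ‖^{N+1} < ‖ϖ‖^k` does not
change the norm). This is how `λ̄(F) ≤ k` is certified from `N + 1 ≥ k + 1` special values.
[cite: Washington1997, §5.2 Thm. 5.11 and §7.2] -/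
theorem isUnit_coeff_of_dualCertificate {F : PowerSeries (PadicComplexInt p)} {m N k : ℕ}
    {x v c : Fin m → ℂ_[p]} {ϖ : ℂ_[p]} (hϖ0 : 0 < ‖ϖ‖) (hϖ : ‖ϖ‖ < 1) (hx : ∀ t, ‖x t‖ ≤ ‖ϖ‖)
    (hc : ∀ t, ‖c t‖ ≤ 1) (hv : ∀ t, IntSeries.HasValueAt F (x t) (v t)) (hk : k ≤ N)
    (hdual : ∀ j ≤ N, ∑ t, c t * x t ^ j = if j = k then ϖ ^ k else 0)
    (hcert : ‖∑ t, c t * v t‖ = ‖ϖ‖ ^ k) :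
    IsUnit (PowerSeries.coeff k F) := by
  have hle := norm_dualPairing_sub_coeff_le hϖ hx hc hv hk hdual
  have hlt : ‖ϖ‖ ^ (N + 1) < ‖ϖ‖ ^ k := pow_lt_pow_right_of_lt_one₀ hϖ0 hϖ (Nat.lt_succ_of_le hk)
  set a : ℂ_[p] := ∑ t, c t * v t with ha
  set b : ℂ_[p] := ((PowerSeries.coeff k F : PadicComplexInt p) : ℂ_[p]) * ϖ ^ k with hb
  -- `‖b‖ = ‖a‖`: otherwise the ultrametric equality `‖a - b‖ = max ‖a‖ ‖b‖ ≥ ‖a‖ = ‖ϖ‖^k` contradicts `hle`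
  have hba : ‖b‖ = ‖ϖ‖ ^ k := by
    by_contra hne
    have hne' : ‖a‖ ≠ ‖-b‖ := by rw [norm_neg, hcert]; exact fun h ↦ hne h.symm
    have hmax := IsUltrametricDist.norm_add_eq_max_of_norm_ne_norm hne'
    rw [← sub_eq_add_neg, norm_neg] at hmax
    have : ‖ϖ‖ ^ k ≤ ‖a - b‖ := by rw [hmax, hcert]; exact le_max_left _ _
    linarith
  rw [hb, norm_mul, norm_pow] at hba
  have hk0 : (0 : ℝ) < ‖ϖ‖ ^ k := pow_pos hϖ0 k
  have hnorm : ‖((PowerSeries.coeff k F : PadicComplexInt p) : ℂ_[p])‖ = 1 := by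
    have := mul_right_cancel₀ hk0.ne' (hba.trans (one_mul _).symm)
    exact this
  exact isUnit_padicComplexInt_iff.mpr hnorm

/-- **Non-unit certificate from values.** Same setting: if the dual pairing of the values has norm
`< ‖ϖ‖^k`, then `[T^k]F` is NOT a unit. With the previous theorem, `λ̄(F) = k` is certified by `k`
non-unit certificates and one unit certificate. [cite: Washington1997, §5.2 Thm. 5.11 and §7.2] -/
theorem not_isUnit_coeff_of_dualCertificate {F : PowerSeries (PadicComplexInt p)} {m N k : ℕ}
    {x v c : Fin m → ℂ_[p]} {ϖ : ℂ_[p]} (hϖ0 : 0 < ‖ϖ‖) (hϖ : ‖ϖ‖ < 1) (hx : ∀ t, ‖x t‖ ≤ ‖ϖ‖)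
    (hc : ∀ t, ‖c t‖ ≤ 1) (hv : ∀ t, IntSeries.HasValueAt F (x t) (v t)) (hk : k ≤ N)
    (hdual : ∀ j ≤ N, ∑ t, c t * x t ^ j = if j = k then ϖ ^ k else 0)
    (hcert : ‖∑ t, c t * v t‖ < ‖ϖ‖ ^ k) :
    ¬ IsUnit (PowerSeries.coeff k F) := by
  intro hunit
  have hle := norm_dualPairing_sub_coeff_le hϖ hx hc hv hk hdual
  have hlt : ‖ϖ‖ ^ (N + 1) < ‖ϖ‖ ^ k := pow_lt_pow_right_of_lt_one₀ hϖ0 hϖ (Nat.lt_succ_of_le hk)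
  have hb : ‖((PowerSeries.coeff k F : PadicComplexInt p) : ℂ_[p]) * ϖ ^ k‖ = ‖ϖ‖ ^ k := by
    rw [norm_mul, norm_pow, isUnit_padicComplexInt_iff.mp hunit, one_mul]
  set a : ℂ_[p] := ∑ t, c t * v t with ha
  set b : ℂ_[p] := ((PowerSeries.coeff k F : PadicComplexInt p) : ℂ_[p]) * ϖ ^ k
  have hne : ‖a‖ ≠ ‖-b‖ := by rw [norm_neg, hb]; exact hcert.ne
  have hmax := IsUltrametricDist.norm_add_eq_max_of_norm_ne_norm hne
  rw [← sub_eq_add_neg, norm_neg, hb] at hmax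
  have : ‖ϖ‖ ^ k ≤ ‖a - b‖ := by rw [hmax]; exact le_max_right _ _
  linarith

end Literature.NumberTheory.EllipticCurves.IntSeries

end
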